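import Mathlib
import HarnessLib
import Summits.HubbardSuperconductivity.HubbardSuperconductivity.Theorems.KLProgrammeKLRegimeTwoVolumeLipDefectDefs

/-!
# Route `KLProgramme` — crux K3 ENGINE (stmt-HubbardSuperconductivity-20437), stub (e) proof-input «(e)-D-ROWS», F-D6 (defs): THE RE-SECTORISATION
# (JUMP) MATRIX `klJump`, THE RE-MEASURED BORN TERM, AND THE INPUT DIFFERENCE AS BASE + RE-MEASURED BORN DIFFERENCES
# (seat hubbard-kl-k3c4-p1 g23; `--supports` 20437; DROWS-SCOPE-g23 §9.4 F-D6)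

The input of block `k` of the two-volume Lipschitz tower is analysed at the thin family `F_{dk−1}` (`…TwoVolumeLipTowerDefs.klLipInput`), while the born term
of an earlier block `k′ < k` is analysed at `F_{dk′}` (`klLipBorn`).  E1 re-measures `Δ_{k′}` at `F_{dk−1}` (`…EngineTowerRemeasureWt`,
`…EngineTowerMeasuredSubadditive.klTowerMeasWt_le_remeasured_sum`, block length `d ≥ 2`); the (D) rows need the same for the DIFFERENCE tower, which is once
more a transfer-door situation (`…TwoVolumeLipGlueTransfer.klGlue_transfer_le`) with the JUMP matrix as transfer.  This file supplies the objects: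

* §1 **`klJump V M β μ K J′ J`** `:= (ε • E_V(F_{J′})) · S_V(F̃_J)` — the re-sectorisation matrix from family `J` to a finer family `J′` (route A's one-step
  `…TwoVolumeTowerDefs.klReanalysis` is `J′ = J + 1`; the block transfer `klLipTransfer … d k` is `(J′, J) = (dk, dk − 1)`, `klLipTransfer_eq_klJump`, `rfl`);
  `klJump_eq_smul`; **`sectorPreimage_eq_map_klJump`** — for `J + 1 ≤ J′`, `sectorPreimage β F_{J′} G = map (toLin′ klJump_{J′J}) (sectorPreimage β F_J G)`
  (the plateau identity `…LipBlockIdentity.map_sectorAnalysis_map_sectorSub_sectorPreimage_of_plateau`, plateau facts of the engine families);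
  **`klJump_periodise`** — `Σ_{res Y″ = Y} klJump (bL) X′ Y″ = klJump L (res X′) Y` (`sectorOverlap_periodise_leg` at the sampled families, as for
  `klLipTransfer_periodise`).
* §2 `klGlue_sum`; **`sectorPreimage_klTowerIncr_eq_map_klJump_klLipBorn`** — `Δ_{k′}` re-measured at `F_{J′}` is `map (toLin′ klJump_{J′, dk′}) (klLipBorn … d k′)`;
  **`klLipInputDiff_eq_base_add_sum`** — for `2 ≤ d`: `D_k = (𝒱₀(bL) − glue 𝒱₀(L), analysed at F_{dk−1}) + Σ_{k′<k} (map klJump′ (klLipBorn (bL) k′) −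
  klGlue (map klJump (klLipBorn L k′)))` — each summand is `klGlue_transfer_le`'s element with `W′ − klGlue W = klLipBornDiff … k′`.

Definitions and identities only; nothing asserts the (D) rows, stub (e), VL, K3 or superconductivity.
References: BGM 2006 §2.7 (2.71), §2.8 (2.76), (2.82)–(2.84) [cite: BenfattoGiulianiMastropietro2006].
-/

namespace Summit.HubbardSuperconductivity.HubbardSuperconductivity.Theorems.TwoVolumeLip

set_option linter.dupNamespace false -- summit = problem name (single-conjunct summit), D-0017

open Finset Literature.MathematicalPhysics.QuantumLattice GrassmannAlgebra Literature.Probability.LatticeModels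
open Literature.MathematicalPhysics.QuantumLattice.FermiRG
open Summit.HubbardSuperconductivity.HubbardSuperconductivity.Theorems.KLRegimeSplit
open Summit.HubbardSuperconductivity.HubbardSuperconductivity.Theorems.KLProgrammeLegKernels
open Summit.HubbardSuperconductivity.HubbardSuperconductivity.Theorems.DispersionFlow
open Summit.HubbardSuperconductivity.HubbardSuperconductivity.Theorems.EngineV8
open Summit.HubbardSuperconductivity.HubbardSuperconductivity.Theorems.TwoVolumeSource
open Summit.HubbardSuperconductivity.HubbardSuperconductivity.Theorems.TwoVolumeDefect
open Summit.HubbardSuperconductivity.HubbardSuperconductivity.Theorems.TwoPointAssembly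
open Summit.HubbardSuperconductivity.HubbardSuperconductivity.Theorems.TorusFourierL2

noncomputable section

/-! ## §1 The jump matrix -/

section OneVolume

variable (V M : ℕ) [NeZero V]

/-- **`klJump V M β μ K J′ J`** — the RE-SECTORISATION (jump) matrix from the thin family `F_J` to the finer thin family `F_{J′}` at volume `V`:
`(ε • E_V(F_{J′})) · S_V(F̃_J)`, `ε = imagTimeWeight β M`, `F̃_J` the fat partner. [cite: BenfattoGiulianiMastropietro2006, §2.7 (2.71)] -/
def klJump (β μ : ℝ) (K : TrigPolyC4v) (J' J : ℕ) :
    Matrix (SpaceTimeIdx V M × SectorLeg (sectorCount J')) (SpaceTimeIdx V M × SectorLeg (sectorCount J)) ℂ :=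
  ((((imagTimeWeight β M : ℝ) : ℂ)) • sectorAnalysisMatrix V M β (klAnisoFamily V M β μ K klE0 J')) *
    sectorSubMatrix V M β (bgmFatMultiplier V M klE0 β (nambuXiCT V μ K) J)

variable {V M}

/-- Unfolding `klJump`. -/
theorem klJump_def (β μ : ℝ) (K : TrigPolyC4v) (J' J : ℕ) :
    klJump V M β μ K J' J = ((((imagTimeWeight β M : ℝ) : ℂ)) • sectorAnalysisMatrix V M β (klAnisoFamily V M β μ K klE0 J')) *
      sectorSubMatrix V M β (bgmFatMultiplier V M klE0 β (nambuXiCT V μ K) J) := rfl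

/-- `klJump = ε • (E · S)`. -/
theorem klJump_eq_smul (β μ : ℝ) (K : TrigPolyC4v) (J' J : ℕ) :
    klJump V M β μ K J' J = (((imagTimeWeight β M : ℝ) : ℂ)) •
      (sectorAnalysisMatrix V M β (klAnisoFamily V M β μ K klE0 J') * sectorSubMatrix V M β (bgmFatMultiplier V M klE0 β (nambuXiCT V μ K) J)) := by
  rw [klJump, Matrix.smul_mul]

/-- The block transfer is the jump `(dk, dk − 1)`. -/
theorem klLipTransfer_eq_klJump (β μ : ℝ) (K : TrigPolyC4v) (d k : ℕ) :
    klLipTransfer V M β μ K d k = klJump V M β μ K (d * k) (d * k - 1) := rfl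

/-- **Re-analysis at a finer family is the jump of the coarser analysis**: for `J + 1 ≤ J′` and any `G`,
`sectorPreimage β F_{J′} G = map (toLin′ (klJump V M β μ K J′ J)) (sectorPreimage β F_J G)` — the plateau identity
(`map_sectorAnalysis_map_sectorSub_sectorPreimage_of_plateau`) with the engine's plateau facts (`bgmFatMultiplier_mul_bgmMultiplier`,
`klAnisoFamily_eq_zero_of_sum_eq_zero`, `sum_klAnisoFamily_eq_one_of_klAnisoFamily_ne_zero`), the `ε`-scaling carried as `map (toLin′ (ε • 1))`. -/
theorem sectorPreimage_eq_map_klJump [NeZero M] {β : ℝ} (hβ : β ≠ 0) (μ : ℝ) (K : TrigPolyC4v) {J' J : ℕ} (hJ : J + 1 ≤ J')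
    (G : HubbardGrassmann V M) :
    sectorPreimage β (klAnisoFamily V M β μ K klE0 J') G =
      ExteriorAlgebra.map (Matrix.toLin' (klJump V M β μ K J' J)) (sectorPreimage β (klAnisoFamily V M β μ K klE0 J) G) := by
  have he : (0 : ℝ) < klE0 := by norm_num [klE0]
  have hFF : ∀ ω p, bgmFatMultiplier V M klE0 β (nambuXiCT V μ K) J ω p * klAnisoFamily V M β μ K klE0 J ω p =
      klAnisoFamily V M β μ K klE0 J ω p :=
    fun ω p => bgmFatMultiplier_mul_bgmMultiplier he β (nambuXiCT V μ K) J ω p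
  have hF0 : ∀ p, ∑ ω, klAnisoFamily V M β μ K klE0 J ω p = 0 → ∀ ω, klAnisoFamily V M β μ K klE0 J ω p = 0 :=
    fun p hp ω => klAnisoFamily_eq_zero_of_sum_eq_zero β μ K klE0 J p hp ω
  have hF'pl : ∀ (ω' : Fin (sectorCount J')) (p : FreqMomentum V M), klAnisoFamily V M β μ K klE0 J' ω' p ≠ 0 →
      ∑ ω, klAnisoFamily V M β μ K klE0 J ω p = 1 :=
    fun ω' p h => sum_klAnisoFamily_eq_one_of_klAnisoFamily_ne_zero β μ K hJ ω' p h
  have hm : klJump V M β μ K J' J =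
      ((((imagTimeWeight β M : ℝ) : ℂ)) • (1 : Matrix (SpaceTimeIdx V M × SectorLeg (sectorCount J')) (SpaceTimeIdx V M × SectorLeg (sectorCount J')) ℂ)) *
        (sectorAnalysisMatrix V M β (klAnisoFamily V M β μ K klE0 J') * sectorSubMatrix V M β (bgmFatMultiplier V M klE0 β (nambuXiCT V μ K) J)) := by
    rw [klJump, Matrix.smul_mul, Matrix.smul_mul, Matrix.one_mul]
  rw [hm, Matrix.toLin'_mul, Matrix.toLin'_mul, ← map_map_eq_map_comp, ← map_map_eq_map_comp,
    map_sectorAnalysis_map_sectorSub_sectorPreimage_of_plateau hβ _ _ hFF hF0 _ hF'pl, ← sectorPreimage_eq_map_map]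

end OneVolume

/-! ## §1b Periodisation of the jump matrix -/

section TwoVolumes

variable {L b M : ℕ} [NeZero L] [NeZero (b * L)] [NeZero M]

/-- **(P_J) for the jump matrices**: `Σ_{res Y″ = Y} klJump (bL) … X′ Y″ = klJump L … (res X′) Y` (`β ≠ 0`; sampled thin / fat families,
`sectorOverlap_periodise_leg`, exactly as `klLipTransfer_periodise`). -/
theorem klJump_periodise {β : ℝ} (hβ : β ≠ 0) (μ : ℝ) (K : TrigPolyC4v) (J' J : ℕ)
    (X' : SpaceTimeIdx (b * L) M × SectorLeg (sectorCount J')) (Y : SpaceTimeIdx L M × SectorLeg (sectorCount J)) :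
    ∑ Y'' ∈ univ.filter (fun Y'' : SpaceTimeIdx (b * L) M × SectorLeg (sectorCount J) => klResLabel L b M (sectorCount J) Y'' = Y),
        klJump (b * L) M β μ K J' J X' Y'' =
      klJump L M β μ K J' J (klResLabel L b M (sectorCount J') X') Y := by
  classical
  simp only [klResLabel, klJump_eq_smul, Matrix.smul_apply, smul_eq_mul, ← mul_sum]
  rw [sectorOverlap_periodise_leg (Lf := b * L) (b := b) (L := L) rfl hβ
    (fun (ω' : Fin (sectorCount J')) (i' : MatsubaraIdx M) (p : Fin 2 → ℝ) =>
      (((gnScaleCutoff 4 klE0 (-((J' : ℕ) : ℤ)) (Real.sqrt (matsubaraFreq β M i' ^ 2 + (-2 * ∑ j, Real.cos (p j) - μ - K.eval p) ^ 2)) *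
          sectorWeightCirc J' ω' (polarAngle (fun j => toIocMod Real.two_pi_pos (-Real.pi) (p j))) : ℝ) : ℂ)))
    (fun (ω' : Fin (sectorCount J)) (i' : MatsubaraIdx M) (p : Fin 2 → ℝ) =>
      (((gnScaleCutoff 4 klE0 (-((J : ℕ) : ℤ) + 1) (Real.sqrt (matsubaraFreq β M i' ^ 2 + (-2 * ∑ j, Real.cos (p j) - μ - K.eval p) ^ 2)) *
          ∑ ω'' ∈ (range (sectorCount J)).filter
            (fun ω'' : ℕ => ∃ δ : ℤ, |δ| ≤ 1 ∧ (sectorCount J : ℤ) ∣ ((ω'' : ℤ) - ((ω' : ℕ) : ℤ) - δ)),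
            sectorWeightCirc J ω'' (polarAngle (fun j => toIocMod Real.two_pi_pos (-Real.pi) (p j))) : ℝ) : ℂ)))
    (klAnisoFamily L M β μ K klE0 J') (klAnisoFamily (b * L) M β μ K klE0 J')
    (fun ω i q => klAnisoFamily_eq_sampled β μ K klE0 J' ω i q) (fun ω i q => klAnisoFamily_eq_sampled β μ K klE0 J' ω i q)
    (bgmFatMultiplier L M klE0 β (nambuXiCT L μ K) J) (bgmFatMultiplier (b * L) M klE0 β (nambuXiCT (b * L) μ K) J)
    (fun ω i q => bgmFatMultiplier_nambuXiCT_eq_sampled klE0 β μ K J ω i q)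
    (fun ω i q => bgmFatMultiplier_nambuXiCT_eq_sampled klE0 β μ K J ω i q)
    (klBlockEquiv L b M (sectorCount J)) (klBlockEquiv_snd L b M (sectorCount J)) X' Y, klBlockEquiv_snd]


/-! ## §2 The re-measured born term and the input difference as base + re-measured born differences -/

omit [NeZero M] in
/-- `klGlue` of a finite sum. -/
theorem klGlue_sum {N : ℕ} {ι : Type*} (s : Finset ι) (W : ι → GrassmannAlgebra ℂ (SpaceTimeIdx L M × SectorLeg N)) :
    klGlue L b M N (∑ i ∈ s, W i) = ∑ i ∈ s, klGlue L b M N (W i) := by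
  simp only [klGlue, map_sum]
  exact Finset.sum_comm

/-- **The born term of block `k′` re-measured at a finer family** `F_{J′}`, `dk′ + 1 ≤ J′`:
`sectorPreimage β F_{J′} Δ_{k′} = map (toLin′ klJump_{J′, dk′}) (klLipBorn V … d k′)`. -/
theorem sectorPreimage_klTowerIncr_eq_map_klJump_klLipBorn {V : ℕ} [NeZero V] {β : ℝ} (hβ : β ≠ 0) (U μ : ℝ) (K : TrigPolyC4v) {d k' J' : ℕ}
    (hJ : d * k' + 1 ≤ J') :
    sectorPreimage β (klAnisoFamily V M β μ K klE0 J') (klTowerIncr V M β U μ K d k') =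
      ExteriorAlgebra.map (Matrix.toLin' (klJump V M β μ K J' (d * k'))) (klLipBorn V M β U μ K d k') := by
  rw [klLipBorn_def, sectorPreimage_eq_map_klJump hβ μ K hJ]

/-- **F-D6 (identity) — the input difference of block `k` as BASE + RE-MEASURED BORN DIFFERENCES** (`2 ≤ d`):
`D_k = (sectorPreimage F_{dk−1}(bL) 𝒱₀(bL) − klGlue (sectorPreimage F_{dk−1}(L) 𝒱₀(L))) + Σ_{k′<k} (map klJump′_{dk−1, dk′} (klLipBorn (bL) k′) −
klGlue (map klJump_{dk−1, dk′} (klLipBorn L k′)))` — `klTowerInput_eq_zero_add_sum`, linearity of `sectorPreimage` / `klGlue`, and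
`sectorPreimage_klTowerIncr_eq_map_klJump_klLipBorn` (`dk′ + 1 ≤ dk − 1` from `k′ < k`, `2 ≤ d`).  Each summand is the element of
`…LipGlueTransfer.klGlue_transfer_le` with `T′, T := klJump (bL), klJump L` (periodised by `klJump_periodise`) and defect `klLipBornDiff … d k′`. -/
theorem klLipInputDiff_eq_base_add_sum {β : ℝ} (hβ : β ≠ 0) (U μ : ℝ) (K : TrigPolyC4v) {d : ℕ} (hd : 2 ≤ d) (k : ℕ) :
    klLipInputDiff L b M β U μ K d k =
      (sectorPreimage β (klAnisoFamily (b * L) M β μ K klE0 (d * k - 1)) (klEffectiveAction (b * L) M β U μ K klE0 0) -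
          klGlue L b M (sectorCount (d * k - 1)) (sectorPreimage β (klAnisoFamily L M β μ K klE0 (d * k - 1)) (klEffectiveAction L M β U μ K klE0 0))) +
        ∑ k' ∈ range k,
          (ExteriorAlgebra.map (Matrix.toLin' (klJump (b * L) M β μ K (d * k - 1) (d * k'))) (klLipBorn (b * L) M β U μ K d k') -
            klGlue L b M (sectorCount (d * k - 1))
              (ExteriorAlgebra.map (Matrix.toLin' (klJump L M β μ K (d * k - 1) (d * k'))) (klLipBorn L M β U μ K d k'))) := by
  have hJ : ∀ k' ∈ range k, d * k' + 1 ≤ d * k - 1 := by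
    intro k' hk'
    have h1 : d * (k' + 1) ≤ d * k := Nat.mul_le_mul_left d (mem_range.1 hk')
    rw [Nat.mul_succ] at h1
    omega
  have hsum : ∀ (V : ℕ) [NeZero V],
      sectorPreimage β (klAnisoFamily V M β μ K klE0 (d * k - 1)) (klTowerInput V M β U μ K d k) =
        sectorPreimage β (klAnisoFamily V M β μ K klE0 (d * k - 1)) (klEffectiveAction V M β U μ K klE0 0) +
          ∑ k' ∈ range k, ExteriorAlgebra.map (Matrix.toLin' (klJump V M β μ K (d * k - 1) (d * k'))) (klLipBorn V M β U μ K d k') := by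
    intro V _
    rw [klTowerInput_eq_zero_add_sum, sectorPreimage_add, sectorPreimage_eq_map_smul_sectorAnalysis β _ (∑ k' ∈ range k, _), map_sum]
    congr 1
    refine Finset.sum_congr rfl fun k' hk' => ?_
    rw [← sectorPreimage_eq_map_smul_sectorAnalysis, sectorPreimage_klTowerIncr_eq_map_klJump_klLipBorn hβ U μ K (hJ k' hk')]
  rw [klLipInputDiff_def, klLipInput_def, klLipInput_def, hsum (b * L), hsum L, klGlue_add, klGlue_sum, Finset.sum_sub_distrib]
  abel

end TwoVolumes

end

end Summit.HubbardSuperconductivity.HubbardSuperconductivity.Theorems.TwoVolumeLip
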